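import Mathlib
import HarnessLib

/-!
# Route `PoloidalWindowDoor`, crux `PoloidalWindowRigidity` (stmt-NavierStokesRegularity-19708) — LINE 18 «leaf_uniform»
# (ns-idea-8 g9, v1.3.1): the CALCULUS CORE of the ridge invariant R8 `RidgeInvariant` (generic lemmas, Mathlib only)

Seat ns-es-p1 g7 (free prover hand keyed by director-ns g18, KEY-NS #190 (3)).  This module carries no Navier–Stokes content: it is
the pure-calculus identity behind R8, split off so that the assembly file `…LeafUniformRidgeInvariant` stays under the size lint and
so that the generic directional-derivative lemmas are importable by the R16/R19 hands of the same line.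

* generic directional-derivative calculus of real functions on a normed space: Leibniz once and twice for `φ₁ψ₁ + φ₂ψ₂`
  (`fderiv_two_products_apply`, `fderiv2_two_products_apply`), Schwarz symmetry in directional form (`fderiv_dir_comm`), the
  chain rule along a curve (`hasDerivAt_comp_curve`), coordinates on `ℝ³` (`clm_apply_eq_sum_three`, `fderiv_apply_coord`);
* `ridge_core`: for smooth `P₀, P₁ : ℝ³ → ℝ` with `∂₁P₀ = ∂₀P₁`, a smooth field `ω` with `ω₂ ≡ 0`, `∂₀ω₀ + ∂₁ω₁ ≡ 0` and the
  «frozen law» `ω₀P₀ + ω₁P₁ ≡ 0`, and an integral curve `γ` of `ω` on `(−ε, ε)` along which `P₀ = P₁ = 0` and `ω ≠ 0`: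
  `(∂₀P₀ + ∂₁P₁)(γ τ)·‖ω(γ 0)‖² = (∂₀P₀ + ∂₁P₁)(γ 0)·‖ω(γ τ)‖²`.  (In R8: `Pⱼ = ∂ⱼv₂(−1,·)`, `ω = curl v(−1,·)`, so
  `∂₀P₀ + ∂₁P₁ = Δₕv₂`.)  Proof: the kernel relations `ω₀∂₀Pⱼ + ω₁∂₁Pⱼ = 0` (differentiate `Pⱼ ∘ γ ≡ 0`), the frozen law
  differentiated twice in the direction `eᵢ` and evaluated on the arc, Schwarz symmetry twice, and a 2×2 `linear_combination`
  give `f′g = fg′` for `f = (∂₀P₀ + ∂₁P₁) ∘ γ`, `g = ‖ω ∘ γ‖²`; then `f/g` is constant (`IsOpen.is_const_of_deriv_eq_zero`).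

HONEST LABEL: calculus lemmas; nothing about any crux, route item or Navier–Stokes regularity is proved here (all OPEN).
-/

noncomputable section

-- the summit and its single sub-problem share the name (CONVENTIONS §1), as in every Theorems file
set_option linter.dupNamespace false

namespace Summit.NavierStokesRegularity.NavierStokesRegularity.Theorems.PoloidalWindowDoorPoloidalWindowRigidityLeafUniformRidgeCore

open Set Function Filter Topology Metric

/-! ## Generic calculus of directional derivatives of real functions -/

section Generic

variable {E : Type*} [NormedAddCommGroup E] [NormedSpace ℝ E]

/-- Leibniz rule for a directional derivative of a product of two real functions. [folklore] -/
theorem fderiv_mul_apply_dir {φ ψ : E → ℝ} {x : E} (hφ : DifferentiableAt ℝ φ x)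
    (hψ : DifferentiableAt ℝ ψ x) (a : E) :
    fderiv ℝ (fun y => φ y * ψ y) x a = fderiv ℝ φ x a * ψ x + φ x * fderiv ℝ ψ x a := by
  rw [fderiv_fun_mul hφ hψ]
  simp only [add_apply, FunLike.coe_smul, Pi.smul_apply, smul_eq_mul]
  ring

/-- Directional derivative of a sum of two products `φ₁ψ₁ + φ₂ψ₂`. [folklore] -/
theorem fderiv_two_products_apply {φ₁ ψ₁ φ₂ ψ₂ : E → ℝ} {x : E}
    (h₁ : DifferentiableAt ℝ φ₁ x) (g₁ : DifferentiableAt ℝ ψ₁ x)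
    (h₂ : DifferentiableAt ℝ φ₂ x) (g₂ : DifferentiableAt ℝ ψ₂ x) (a : E) :
    fderiv ℝ (fun y => φ₁ y * ψ₁ y + φ₂ y * ψ₂ y) x a =
      (fderiv ℝ φ₁ x a * ψ₁ x + φ₁ x * fderiv ℝ ψ₁ x a) +
        (fderiv ℝ φ₂ x a * ψ₂ x + φ₂ x * fderiv ℝ ψ₂ x a) := by
  have e : HasFDerivAt (fun y => φ₁ y * ψ₁ y + φ₂ y * ψ₂ y)
      ((φ₁ x • fderiv ℝ ψ₁ x + ψ₁ x • fderiv ℝ φ₁ x) + (φ₂ x • fderiv ℝ ψ₂ x + ψ₂ x • fderiv ℝ φ₂ x)) x :=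
    (h₁.hasFDerivAt.mul g₁.hasFDerivAt).add (h₂.hasFDerivAt.mul g₂.hasFDerivAt)
  rw [e.fderiv]
  simp only [add_apply, FunLike.coe_smul, Pi.smul_apply, smul_eq_mul]
  ring

/-- The directional derivative `y ↦ Dφ(y)a` of a `C^{n+1}` real function is `C^n`. [folklore] -/
theorem contDiff_fderiv_apply_dir {φ : E → ℝ} {n : WithTop ℕ∞} (hφ : ContDiff ℝ (n + 1) φ) (a : E) :
    ContDiff ℝ n (fun y => fderiv ℝ φ y a) :=
  (hφ.fderiv_right le_rfl).clm_apply contDiff_const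

/-- Nested directional derivatives are the second derivative: `D(y ↦ Dφ(y)a)(x)b = D²φ(x) b a`. [folklore] -/
theorem fderiv_fderiv_apply_dir {φ : E → ℝ} {x : E} (hφ : ContDiffAt ℝ 2 φ x) (a b : E) :
    fderiv ℝ (fun y => fderiv ℝ φ y a) x b = fderiv ℝ (fderiv ℝ φ) x b a := by
  have hd : DifferentiableAt ℝ (fderiv ℝ φ) x :=
    (hφ.fderiv_right (m := 1) (by norm_num)).differentiableAt (by simp)
  have h : (fun y => fderiv ℝ φ y a) = (⇑(ContinuousLinearMap.apply ℝ ℝ a)) ∘ (fderiv ℝ φ) := by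
    funext y; rfl
  rw [h, ((ContinuousLinearMap.apply ℝ ℝ a).hasFDerivAt.comp x hd.hasFDerivAt).fderiv]
  rfl

/-- Symmetry of mixed directional derivatives of a `C²` real function (Schwarz). [folklore] -/
theorem fderiv_dir_comm {φ : E → ℝ} {x : E} (hφ : ContDiffAt ℝ 2 φ x) (a b : E) :
    fderiv ℝ (fun y => fderiv ℝ φ y a) x b = fderiv ℝ (fun y => fderiv ℝ φ y b) x a := by
  rw [fderiv_fderiv_apply_dir hφ, fderiv_fderiv_apply_dir hφ]
  exact hφ.isSymmSndFDerivAt (by simp only [minSmoothness_of_isRCLikeNormedField]; exact le_rfl) b a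

/-- Chain rule along a curve: `(φ ∘ γ)′(τ) = Dφ(γ τ) γ′(τ)`. [folklore] -/
theorem hasDerivAt_comp_curve {φ : E → ℝ} {γ : ℝ → E} {τ : ℝ} {V : E}
    (hφ : DifferentiableAt ℝ φ (γ τ)) (hγ : HasDerivAt γ V τ) :
    HasDerivAt (fun t => φ (γ t)) (fderiv ℝ φ (γ τ) V) τ :=
  hφ.hasFDerivAt.comp_hasDerivAt τ hγ

/-- Second directional derivative (same direction twice) of `φ₁ψ₁ + φ₂ψ₂` for `C²` real functions (Leibniz twice). [folklore] -/
theorem fderiv2_two_products_apply {φ₁ ψ₁ φ₂ ψ₂ : E → ℝ}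
    (h₁ : ContDiff ℝ 2 φ₁) (g₁ : ContDiff ℝ 2 ψ₁) (h₂ : ContDiff ℝ 2 φ₂) (g₂ : ContDiff ℝ 2 ψ₂)
    (a x : E) :
    fderiv ℝ (fun y => fderiv ℝ (fun z => φ₁ z * ψ₁ z + φ₂ z * ψ₂ z) y a) x a =
      (fderiv ℝ (fun y => fderiv ℝ φ₁ y a) x a * ψ₁ x + 2 * (fderiv ℝ φ₁ x a * fderiv ℝ ψ₁ x a) +
          φ₁ x * fderiv ℝ (fun y => fderiv ℝ ψ₁ y a) x a) +
        (fderiv ℝ (fun y => fderiv ℝ φ₂ y a) x a * ψ₂ x + 2 * (fderiv ℝ φ₂ x a * fderiv ℝ ψ₂ x a) +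
          φ₂ x * fderiv ℝ (fun y => fderiv ℝ ψ₂ y a) x a) := by
  have two : (2 : WithTop ℕ∞) = 1 + 1 := by norm_num
  have d1 : ∀ {φ : E → ℝ}, ContDiff ℝ 2 φ → Differentiable ℝ φ := fun h => h.differentiable (by norm_num)
  have d2 : ∀ {φ : E → ℝ}, ContDiff ℝ 2 φ → Differentiable ℝ (fun y => fderiv ℝ φ y a) := fun h =>
    (contDiff_fderiv_apply_dir (n := 1) (by rw [two] at h; exact h) a).differentiable one_ne_zero
  have hfirst : (fun y => fderiv ℝ (fun z => φ₁ z * ψ₁ z + φ₂ z * ψ₂ z) y a) = fun y =>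
      (fun y => fderiv ℝ φ₁ y a) y * ψ₁ y + φ₁ y * (fun y => fderiv ℝ ψ₁ y a) y +
        ((fun y => fderiv ℝ φ₂ y a) y * ψ₂ y + φ₂ y * (fun y => fderiv ℝ ψ₂ y a) y) := by
    funext y
    exact fderiv_two_products_apply (d1 h₁ y) (d1 g₁ y) (d1 h₂ y) (d1 g₂ y) a
  rw [hfirst]
  have e1 := ((d2 h₁ x).hasFDerivAt.mul (d1 g₁ x).hasFDerivAt)
  have e2 := ((d1 h₁ x).hasFDerivAt.mul (d2 g₁ x).hasFDerivAt)
  have e3 := ((d2 h₂ x).hasFDerivAt.mul (d1 g₂ x).hasFDerivAt)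
  have e4 := ((d1 h₂ x).hasFDerivAt.mul (d2 g₂ x).hasFDerivAt)
  have etot := (e1.add e2).add (e3.add e4)
  rw [show (fun y => (fun y => fderiv ℝ φ₁ y a) y * ψ₁ y + φ₁ y * (fun y => fderiv ℝ ψ₁ y a) y +
        ((fun y => fderiv ℝ φ₂ y a) y * ψ₂ y + φ₂ y * (fun y => fderiv ℝ ψ₂ y a) y)) =
      ((fun y => fderiv ℝ φ₁ y a) * ψ₁ + φ₁ * (fun y => fderiv ℝ ψ₁ y a)) +
        ((fun y => fderiv ℝ φ₂ y a) * ψ₂ + φ₂ * (fun y => fderiv ℝ ψ₂ y a)) from rfl]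
  rw [etot.fderiv]
  simp only [add_apply, FunLike.coe_smul, Pi.smul_apply, smul_eq_mul]
  ring

end Generic

section Coordinates

/-! ## Coordinates on `ℝ³` -/

/-- A linear functional on `ℝ³` evaluated at `z`, in coordinates: `L z = Σⱼ zⱼ L eⱼ`. [folklore] -/
theorem clm_apply_eq_sum_three (L : EuclideanSpace ℝ (Fin 3) →L[ℝ] ℝ) (z : EuclideanSpace ℝ (Fin 3)) :
    L z = z 0 * L (EuclideanSpace.single 0 1) + z 1 * L (EuclideanSpace.single 1 1) +
      z 2 * L (EuclideanSpace.single 2 1) := by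
  have hz : z = z 0 • EuclideanSpace.single 0 (1 : ℝ) + z 1 • EuclideanSpace.single 1 (1 : ℝ) +
      z 2 • EuclideanSpace.single 2 (1 : ℝ) := by
    ext i
    fin_cases i <;> simp
  conv_lhs => rw [hz]
  simp only [map_add, map_smul, smul_eq_mul]

/-- Coordinates of the derivative of a vector field on `ℝ³` are the derivatives of its coordinates. [folklore] -/
theorem fderiv_apply_coord {Ψ : EuclideanSpace ℝ (Fin 3) → EuclideanSpace ℝ (Fin 3)}
    {x : EuclideanSpace ℝ (Fin 3)} (hΨ : DifferentiableAt ℝ Ψ x) (h : EuclideanSpace ℝ (Fin 3))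
    (i : Fin 3) : fderiv ℝ Ψ x h i = fderiv ℝ (fun y => Ψ y i) x h := by
  have hc : (fun y => Ψ y i) = (⇑(EuclideanSpace.proj i : EuclideanSpace ℝ (Fin 3) →L[ℝ] ℝ)) ∘ Ψ := by
    funext y; rfl
  rw [hc, ((EuclideanSpace.proj i : EuclideanSpace ℝ (Fin 3) →L[ℝ] ℝ).hasFDerivAt.comp x
    hΨ.hasFDerivAt).fderiv]
  rfl


end Coordinates

/-! ## The core identity (pure calculus) -/

/-- **Core of R8.**  Let `P₀, P₁ : ℝ³ → ℝ` and `ω : ℝ³ → ℝ³` be smooth with `∂₁P₀ = ∂₀P₁` (they are `∂₀w, ∂₁w` of one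
function), the «frozen law» `ω₀P₀ + ω₁P₁ ≡ 0`, `ω₂ ≡ 0` and `∂₀ω₀ + ∂₁ω₁ ≡ 0`; let `γ` be an integral curve of `ω` on `(−ε, ε)`
along which `P₀ = P₁ = 0` and `ω ≠ 0`.  Then `(∂₀P₀ + ∂₁P₁)(γ τ)·‖ω(γ 0)‖² = (∂₀P₀ + ∂₁P₁)(γ 0)·‖ω(γ τ)‖²` for `τ ∈ (−ε, ε)`:
the second derivative of the frozen law in the directions `e₀, e₁`, the kernel relations from `Pⱼ ∘ γ ≡ 0`, Schwarz symmetry and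
the trace condition give `(f/g)′ = 0` for `f = (∂₀P₀ + ∂₁P₁) ∘ γ`, `g = ‖ω ∘ γ‖²`. [folklore] -/
theorem ridge_core {P0 P1 : EuclideanSpace ℝ (Fin 3) → ℝ}
    {ω : EuclideanSpace ℝ (Fin 3) → EuclideanSpace ℝ (Fin 3)} {γ : ℝ → EuclideanSpace ℝ (Fin 3)} {ε τ : ℝ}
    (hP0s : ∀ n : ℕ, ContDiff ℝ n P0) (hP1s : ∀ n : ℕ, ContDiff ℝ n P1) (hωs : ∀ n : ℕ, ContDiff ℝ n ω)
    (hPsym : ∀ x, fderiv ℝ P0 x (EuclideanSpace.single 1 1) = fderiv ℝ P1 x (EuclideanSpace.single 0 1))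
    (hFro : ∀ x, ω x 0 * P0 x + ω x 1 * P1 x = 0)
    (hω2 : ∀ x, ω x 2 = 0)
    (hdivω : ∀ x, fderiv ℝ (fun y => ω y 0) x (EuclideanSpace.single 0 1) +
      fderiv ℝ (fun y => ω y 1) x (EuclideanSpace.single 1 1) = 0)
    (hcrit0 : ∀ t ∈ Ioo (-ε) ε, P0 (γ t) = 0) (hcrit1 : ∀ t ∈ Ioo (-ε) ε, P1 (γ t) = 0)
    (hγ : ∀ t ∈ Ioo (-ε) ε, HasDerivAt γ (ω (γ t)) t)
    (hne : ∀ t ∈ Ioo (-ε) ε, ω (γ t) ≠ 0)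
    (hτ : τ ∈ Ioo (-ε) ε) (h0 : (0 : ℝ) ∈ Ioo (-ε) ε) :
    (fderiv ℝ P0 (γ τ) (EuclideanSpace.single 0 1) + fderiv ℝ P1 (γ τ) (EuclideanSpace.single 1 1)) *
        ‖ω (γ 0)‖ ^ 2 =
      (fderiv ℝ P0 (γ 0) (EuclideanSpace.single 0 1) + fderiv ℝ P1 (γ 0) (EuclideanSpace.single 1 1)) *
        ‖ω (γ τ)‖ ^ 2 := by
  set e0 : EuclideanSpace ℝ (Fin 3) := EuclideanSpace.single 0 1 with he0
  set e1 : EuclideanSpace ℝ (Fin 3) := EuclideanSpace.single 1 1 with he1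
  -- smoothness bookkeeping
  have hωc : ∀ (n : ℕ) (j : Fin 3), ContDiff ℝ n (fun x => ω x j) := fun n j => contDiff_euclidean.1 (hωs n) j
  have hD : ∀ {φ : EuclideanSpace ℝ (Fin 3) → ℝ}, (∀ n : ℕ, ContDiff ℝ n φ) →
      ∀ (a : EuclideanSpace ℝ (Fin 3)) (n : ℕ), ContDiff ℝ n (fun y => fderiv ℝ φ y a) :=
    fun hφ a n => contDiff_fderiv_apply_dir (n := n) (by exact_mod_cast hφ (n + 1)) a
  have hdiff : ∀ {φ : EuclideanSpace ℝ (Fin 3) → ℝ}, (∀ n : ℕ, ContDiff ℝ n φ) → ∀ x, DifferentiableAt ℝ φ x :=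
    fun hφ x => ((hφ 1).differentiable one_ne_zero) x
  have hC2 : ∀ {φ : EuclideanSpace ℝ (Fin 3) → ℝ}, (∀ n : ℕ, ContDiff ℝ n φ) → ∀ x, ContDiffAt ℝ 2 φ x :=
    fun hφ x => (hφ 2).contDiffAt
  -- expansion of a directional derivative along `ω y` (third coordinate vanishes)
  have hexp : ∀ (φ : EuclideanSpace ℝ (Fin 3) → ℝ) (y : EuclideanSpace ℝ (Fin 3)),
      fderiv ℝ φ y (ω y) = ω y 0 * fderiv ℝ φ y e0 + ω y 1 * fderiv ℝ φ y e1 := by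
    intro φ y
    rw [clm_apply_eq_sum_three (fderiv ℝ φ y) (ω y), hω2 y, zero_mul, add_zero]
  -- the frozen law as a function identity, and its second directional derivatives
  have hFfun : (fun z => ω z 0 * P0 z + ω z 1 * P1 z) = fun _ => (0 : ℝ) := funext hFro
  have hE1 : ∀ (a y : EuclideanSpace ℝ (Fin 3)),
      (fderiv ℝ (fun y => fderiv ℝ (fun x => ω x 0) y a) y a * P0 y +
            2 * (fderiv ℝ (fun x => ω x 0) y a * fderiv ℝ P0 y a) +
          ω y 0 * fderiv ℝ (fun y => fderiv ℝ P0 y a) y a) +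
        (fderiv ℝ (fun y => fderiv ℝ (fun x => ω x 1) y a) y a * P1 y +
            2 * (fderiv ℝ (fun x => ω x 1) y a * fderiv ℝ P1 y a) +
          ω y 1 * fderiv ℝ (fun y => fderiv ℝ P1 y a) y a) = 0 := by
    intro a y
    rw [← fderiv2_two_products_apply (hωc 2 0) (hP0s 2) (hωc 2 1) (hP1s 2) a y, hFfun]
    simp
  -- third-order symmetry: the cross terms
  have hX0 : ∀ y, fderiv ℝ (fun x => fderiv ℝ P0 x e0) y e1 = fderiv ℝ (fun x => fderiv ℝ P1 x e0) y e0 := by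
    intro y
    rw [fderiv_dir_comm (hC2 hP0s y) e0 e1, show (fun x => fderiv ℝ P0 x e1) = fun x => fderiv ℝ P1 x e0 from
      funext hPsym]
  have hX1 : ∀ y, fderiv ℝ (fun x => fderiv ℝ P1 x e1) y e0 = fderiv ℝ (fun x => fderiv ℝ P0 x e1) y e1 := by
    intro y
    rw [fderiv_dir_comm (hC2 hP1s y) e1 e0, ← show (fun x => fderiv ℝ P0 x e1) = fun x => fderiv ℝ P1 x e0 from
      funext hPsym]
  -- the pointwise package along the arc
  have step : ∀ t ∈ Ioo (-ε) ε, ∃ f' g' : ℝ,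
      HasDerivAt (fun s => fderiv ℝ P0 (γ s) e0 + fderiv ℝ P1 (γ s) e1) f' t ∧
      HasDerivAt (fun s => ‖ω (γ s)‖ ^ 2) g' t ∧
      f' * ‖ω (γ t)‖ ^ 2 = (fderiv ℝ P0 (γ t) e0 + fderiv ℝ P1 (γ t) e1) * g' := by
    intro t ht
    -- values at y = γ t
    have hy0 : P0 (γ t) = 0 := hcrit0 t ht
    have hy1 : P1 (γ t) = 0 := hcrit1 t ht
    -- (K) kernel relations: differentiate `P_j ∘ γ ≡ 0`
    have hK : ∀ {P : EuclideanSpace ℝ (Fin 3) → ℝ}, (∀ n : ℕ, ContDiff ℝ n P) →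
        (∀ s ∈ Ioo (-ε) ε, P (γ s) = 0) →
        ω (γ t) 0 * fderiv ℝ P (γ t) e0 + ω (γ t) 1 * fderiv ℝ P (γ t) e1 = 0 := by
      intro P hP hPz
      have h1 : HasDerivAt (fun s => P (γ s)) (fderiv ℝ P (γ t) (ω (γ t))) t :=
        hasDerivAt_comp_curve (hdiff hP _) (hγ t ht)
      have h2 : HasDerivAt (fun s => P (γ s)) 0 t := by
        refine (hasDerivAt_const t (0 : ℝ)).congr_of_eventuallyEq ?_
        filter_upwards [Ioo_mem_nhds ht.1 ht.2] with s hs using hPz s hs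
      have h := h1.unique h2
      rwa [hexp] at h
    have hK0 := hK hP0s hcrit0
    have hK1 := hK hP1s hcrit1
    -- (F) derivative of the horizontal Laplacian along the arc
    have hF0 : HasDerivAt (fun s => fderiv ℝ P0 (γ s) e0)
        (ω (γ t) 0 * fderiv ℝ (fun x => fderiv ℝ P0 x e0) (γ t) e0 +
          ω (γ t) 1 * fderiv ℝ (fun x => fderiv ℝ P1 x e0) (γ t) e0) t := by
      have h := hasDerivAt_comp_curve (φ := fun x => fderiv ℝ P0 x e0) (hdiff (hD hP0s e0) _) (hγ t ht)
      rwa [hexp, hX0] at h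
    have hF1 : HasDerivAt (fun s => fderiv ℝ P1 (γ s) e1)
        (ω (γ t) 0 * fderiv ℝ (fun x => fderiv ℝ P0 x e1) (γ t) e1 +
          ω (γ t) 1 * fderiv ℝ (fun x => fderiv ℝ P1 x e1) (γ t) e1) t := by
      have h := hasDerivAt_comp_curve (φ := fun x => fderiv ℝ P1 x e1) (hdiff (hD hP1s e1) _) (hγ t ht)
      rwa [hexp, hX1] at h
    -- (G) derivative of `‖ω ∘ γ‖²`
    have hc : ∀ j : Fin 3, HasDerivAt (fun s => ω (γ s) j)
        (ω (γ t) 0 * fderiv ℝ (fun x => ω x j) (γ t) e0 + ω (γ t) 1 * fderiv ℝ (fun x => ω x j) (γ t) e1) t := by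
      intro j
      have h := hasDerivAt_comp_curve (φ := fun x => ω x j) (hdiff (hωc · j) _) (hγ t ht)
      rwa [hexp] at h
    have hGfun : (fun s => ‖ω (γ s)‖ ^ 2) = fun s => ω (γ s) 0 * ω (γ s) 0 + ω (γ s) 1 * ω (γ s) 1 := by
      funext s
      rw [EuclideanSpace.real_norm_sq_eq, Fin.sum_univ_three, hω2]
      ring
    have hG := ((hc 0).mul (hc 0)).add ((hc 1).mul (hc 1))
    -- abbreviations for the scalars at `y = γ t`
    set ω0 : ℝ := ω (γ t) 0 with hω0
    set ω1 : ℝ := ω (γ t) 1 with hω1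
    set a00 : ℝ := fderiv ℝ P0 (γ t) e0 with ha00
    set a01 : ℝ := fderiv ℝ P0 (γ t) e1 with ha01
    set a10 : ℝ := fderiv ℝ P1 (γ t) e0 with ha10
    set a11 : ℝ := fderiv ℝ P1 (γ t) e1 with ha11
    set A00 : ℝ := fderiv ℝ (fun x => ω x 0) (γ t) e0 with hA00
    set A01 : ℝ := fderiv ℝ (fun x => ω x 1) (γ t) e0 with hA01
    set A10 : ℝ := fderiv ℝ (fun x => ω x 0) (γ t) e1 with hA10
    set A11 : ℝ := fderiv ℝ (fun x => ω x 1) (γ t) e1 with hA11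
    set D00 : ℝ := fderiv ℝ (fun x => fderiv ℝ P0 x e0) (γ t) e0 with hD00
    set D01 : ℝ := fderiv ℝ (fun x => fderiv ℝ P1 x e0) (γ t) e0 with hD01
    set D10 : ℝ := fderiv ℝ (fun x => fderiv ℝ P0 x e1) (γ t) e1 with hD10
    set D11 : ℝ := fderiv ℝ (fun x => fderiv ℝ P1 x e1) (γ t) e1 with hD11
    have hG' : HasDerivAt (fun s => ‖ω (γ s)‖ ^ 2)
        (2 * (ω0 * (ω0 * A00 + ω1 * A10) + ω1 * (ω0 * A01 + ω1 * A11))) t := by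
      rw [hGfun]
      exact hG.congr_deriv (by ring)
    refine ⟨_, _, hF0.add hF1, hG', ?_⟩
    -- (A) the algebra
    have hE10 := hE1 e0 (γ t)
    have hE11 := hE1 e1 (γ t)
    rw [hy0, hy1] at hE10 hE11
    have hsym : a01 = a10 := hPsym (γ t)
    have hdv : A00 + A11 = 0 := hdivω (γ t)
    have hnsq : ‖ω (γ t)‖ ^ 2 = ω0 * ω0 + ω1 * ω1 := by
      rw [EuclideanSpace.real_norm_sq_eq, Fin.sum_univ_three, hω2]; ring
    rw [hnsq]
    linear_combination (ω0 * ω0 + ω1 * ω1) * hE10 + (ω0 * ω0 + ω1 * ω1) * hE11 -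
      2 * (2 * A00 * ω0 + (A01 + A10) * ω1) * hK0 - 2 * (-2 * A00 * ω1 + (A01 + A10) * ω0) * hK1 +
      2 * (2 * A00 * ω0 * ω1 - (A01 + A10) * ω0 ^ 2 + A01 * (ω0 * ω0 + ω1 * ω1)) * hsym -
      2 * ((ω0 * ω0 + ω1 * ω1) * a11 + (a00 + a11) * ω1 ^ 2) * hdv
  -- the ratio `F/G` is constant on the arc
  have hGpos : ∀ t ∈ Ioo (-ε) ε, ‖ω (γ t)‖ ^ 2 ≠ 0 := fun t ht =>
    pow_ne_zero 2 (norm_ne_zero_iff.2 (hne t ht))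
  have hR : ∀ t ∈ Ioo (-ε) ε, HasDerivAt
      (fun s => (fderiv ℝ P0 (γ s) e0 + fderiv ℝ P1 (γ s) e1) / ‖ω (γ s)‖ ^ 2) 0 t := by
    intro t ht
    obtain ⟨f', g', hF, hG, halg⟩ := step t ht
    have h := hF.div hG (hGpos t ht)
    refine h.congr_deriv ?_
    rw [halg, sub_self, zero_div]
  have hconst := IsOpen.is_const_of_deriv_eq_zero (𝕜 := ℝ)
    (f := fun s => (fderiv ℝ P0 (γ s) e0 + fderiv ℝ P1 (γ s) e1) / ‖ω (γ s)‖ ^ 2)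
    isOpen_Ioo isPreconnected_Ioo (fun t ht => (hR t ht).differentiableAt.differentiableWithinAt)
    (fun t ht => (hR t ht).deriv) hτ h0
  rw [div_eq_div_iff (hGpos τ hτ) (hGpos 0 h0)] at hconst
  exact hconst



end Summit.NavierStokesRegularity.NavierStokesRegularity.Theorems.PoloidalWindowDoorPoloidalWindowRigidityLeafUniformRidgeCore

end
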